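import Summits.Ventures.HodgeRepro.Tier3LemmaRCorrespondenceScalars
import Summits.Ventures.HodgeRepro.Tier3WeilLineModule

/-!
# LEMMA R (correspondence form) with the Weil line a `K`-vector space through `act` — by statement

Blind re-derivation cell `pub-hodge-repro`, seat `t3-p4` (Tier 3, T3.5 for T3.4 = Lemma R).  Target tree path
`lean/Summits/Ventures/HodgeRepro/Tier3LemmaRCorrespondenceModule.lean`; imports the cell's
`Tier3LemmaRCorrespondenceScalars` and `Tier3WeilLineModule`.

WHAT THIS FILE STATES.  `exists_weil_line_correspondence_module` = `exists_weil_line_correspondence_scalars` with FOUR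
clauses added right after «`r ∘ act(a) = a • r`»: for `w ∈ W_F`, `act(a + b) w = act(a) w + act(b) w` and `act(0) w = 0`;
everywhere, `act(a b) = act(a) ∘ act(b)` and `act(1) = id` — the module axioms of LEMMA-R-RESIDUE.md §4(d)'s first
sentence («`K` — and its `R`-stable subspace `W_F(B) = e·K` — is an `F`-vector space») on the correspondence theorem's
own data, composed from `Tier3WeilLineModule` with the clauses the statement already carries (`r` injective on `W_F`,
`W_F` `act`-stable, `r ∘ act(a) = a • r`).  Every other clause is verbatim; the proof destructures the landed theorem and
re-assembles it.  Read with `V_B = H¹(B, ℚ)`, `K = F`, `F₀ = ℚ`, `2k = 2p`: `(W_F(B), act) ≅ ∧^{2p}_F H¹(B, ℚ)` through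
`r` is an isomorphism of `F`-VECTOR SPACES, not only of sets with a distinguished generator.  Nothing mathematical moves
(residue 0 unchanged); no definition is introduced.  HC_CM is NOT proved by anyone in this repository.
-/

set_option autoImplicit false

open TensorProduct Finset

namespace HodgeRepro.Tier3

open HodgeRepro.RouteC HodgeRepro.CMHodgeOn

section CorrespondenceModule

variable {F₀ K : Type*} [Field F₀] [Field K] [Algebra F₀ K]
variable {Vr VB : Type*} [AddCommGroup Vr] [Module K Vr] [Module F₀ Vr] [IsScalarTower F₀ K Vr]
  [AddCommGroup VB] [Module K VB] [Module F₀ VB] [IsScalarTower F₀ K VB]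
variable {J ι : Type*} [Fintype J] [DecidableEq J] [Fintype ι] [LinearOrder ι] [DecidableEq (K ≃ₐ[F₀] K)]
variable [FiniteDimensional F₀ K] [IsGalois F₀ K] [Algebra K ℂ]

/-- **LEMMA R with (S2), Deligne's identification, the `K`-structure AND its module axioms in one statement**
(`exists_weil_line_correspondence_scalars` + `Tier3WeilLineModule`): after «`r ∘ act(a) = a • r`», the four clauses
`act(a + b) w = act(a) w + act(b) w` and `act(0) w = 0` for `w ∈ W_F`, `act(a b) = act(a) ∘ act(b)`, `act(1) = id`.
`ι` carries the `LinearOrder` that `Tier3WeilLineScalars` enumerates the wedge basis with (its `DecidableEq` is the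
derived one, as there). -/
theorem exists_weil_line_correspondence_module {k : ℕ} [Nonempty ι]
    (cls : ι → J) (tw : ι → K ≃ₐ[F₀] K) (hinj : Function.Injective fun i => (cls i, tw i))
    (hcard : Fintype.card ι = 2 * k)
    (ω : Module.Basis J K Vr) (ω' : Module.Basis ι K VB) (M : Vr →ₗ[F₀] VB)
    (hM : ∀ (c : K) (j : J), M (c • ω j) = ∑ i ∈ univ.filter (fun i => cls i = j), ((tw i)⁻¹ c) • ω' i)
    [LinearOrder (J × (K ≃ₐ[F₀] K))] [LinearOrder (ι × (K ≃ₐ[F₀] K))]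
    [MulAction (K ≃ₐ[F₀] K) (J × (K ≃ₐ[F₀] K))]
    (hact : ∀ (σ x : K ≃ₐ[F₀] K) (j : J), σ • (j, x) = (j, σ * x))
    [MulAction (K ≃ₐ[F₀] K) (ι × (K ≃ₐ[F₀] K))]
    (hact' : ∀ (σ x : K ≃ₐ[F₀] K) (i : ι), σ • (i, x) = (i, σ * x))
    (i₀ : ι) :
    ∃ (e : Module.Basis (J × (K ≃ₐ[F₀] K)) K (K ⊗[F₀] Vr))
      (E : Module.Basis (Set.powersetCard (J × (K ≃ₐ[F₀] K)) (2 * k)) K (K ⊗[F₀] ⋀[F₀]^(2 * k) Vr))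
      (Φ : K ⊗[F₀] ⋀[F₀]^(2 * k) Vr ≃ₗ[K] ⋀[K]^(2 * k) (K ⊗[F₀] Vr))
      (e' : Module.Basis (ι × (K ≃ₐ[F₀] K)) K (K ⊗[F₀] VB))
      (E' : Module.Basis (Set.powersetCard (ι × (K ≃ₐ[F₀] K)) (2 * k)) K (K ⊗[F₀] ⋀[F₀]^(2 * k) VB))
      (Φ' : K ⊗[F₀] ⋀[F₀]^(2 * k) VB ≃ₗ[K] ⋀[K]^(2 * k) (K ⊗[F₀] VB))
      (WF : Submodule F₀ (⋀[F₀]^(2 * k) VB))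
      (e₀ : ⋀[F₀]^(2 * k) VB →ₗ[F₀] ⋀[F₀]^(2 * k) VB)
      (r : ⋀[F₀]^(2 * k) VB →ₗ[F₀] ⋀[K]^(2 * k) VB),
      (∀ (σ x : K ≃ₐ[F₀] K) (j : J), LinearMap.rTensor Vr σ.toLinearMap (e (j, x)) = e (j, σ * x)) ∧
      (∀ (σ x : K ≃ₐ[F₀] K) (i : ι), LinearMap.rTensor VB σ.toLinearMap (e' (i, x)) = e' (i, σ * x)) ∧
      -- the eigen-relations of `e`, `e′` under the diagonal actions `A b`, `A′ b` and under the scalars of `K`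
      (∀ (x : K ≃ₐ[F₀] K) (j : J) (b : J → K),
        LinearMap.lTensor K ((ω.constr K fun j => b j • ω j).restrictScalars F₀) (e (j, x)) =
          x (b j) • e (j, x)) ∧
      (∀ (x : K ≃ₐ[F₀] K) (i : ι) (b : ι → K),
        LinearMap.lTensor K ((ω'.constr K fun i => b i • ω' i).restrictScalars F₀) (e' (i, x)) =
          x (b i) • e' (i, x)) ∧
      (∀ (x : K ≃ₐ[F₀] K) (i : ι) (b : K),
        LinearMap.lTensor K ((LinearMap.lsmul K VB b).restrictScalars F₀) (e' (i, x)) = x b • e' (i, x)) ∧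
      (∀ (x : K ≃ₐ[F₀] K) (j : J),
        LinearMap.lTensor K M (e (j, x)) = ∑ i ∈ univ.filter (fun i => cls i = j), e' (i, x * tw i)) ∧
      (∀ (c : K) (v : Fin (2 * k) → Vr),
        Φ (c ⊗ₜ[F₀] exteriorPower.ιMulti F₀ (2 * k) v) =
          c • exteriorPower.ιMulti K (2 * k) (fun i => (1 : K) ⊗ₜ[F₀] v i)) ∧
      (∀ (c : K) (w : Fin (2 * k) → VB),
        Φ' (c ⊗ₜ[F₀] exteriorPower.ιMulti F₀ (2 * k) w) =
          c • exteriorPower.ιMulti K (2 * k) (fun i => (1 : K) ⊗ₜ[F₀] w i)) ∧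
      (∀ s, Φ (E s) = exteriorPower.ιMulti_family K (2 * k) e s) ∧
      (∀ s, Φ' (E' s) = exteriorPower.ιMulti_family K (2 * k) e' s) ∧
      -- the Weil line and its rational projector
      WF.baseChange K =
        Submodule.span K (E' '' {L | ∃ σ : K ≃ₐ[F₀] K, (L : Finset (ι × (K ≃ₐ[F₀] K))) = lineSet σ}) ∧
      (∀ v, e₀ v ∈ WF) ∧ (∀ w ∈ WF, e₀ w = w) ∧
      (∀ (v : ⋀[F₀]^(2 * k) VB) (L : Set.powersetCard (ι × (K ≃ₐ[F₀] K)) (2 * k)),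
        E'.repr ((1 : K) ⊗ₜ[F₀] e₀ v) L =
          if ∃ σ : K ≃ₐ[F₀] K, (L : Finset (ι × (K ≃ₐ[F₀] K))) = lineSet σ
          then E'.repr ((1 : K) ⊗ₜ[F₀] v) L else 0) ∧
      Module.finrank F₀ WF = Module.finrank F₀ K ∧
      -- Deligne's direct summand: the Weil line IS `⋀[K]^(2k) VB` through the restriction-of-scalars map `r`
      (∀ w : Fin (2 * k) → VB, r (exteriorPower.ιMulti F₀ (2 * k) w) = exteriorPower.ιMulti K (2 * k) w) ∧
      Function.Surjective r ∧
      -- the first corner's multiplication by `a` IS the scalar `a` on `⋀[K]^(2k) VB` through `r`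
      (∀ (a : K) (v : ⋀[F₀]^(2 * k) VB), r (exteriorPower.map (2 * k)
        ((ω'.constr K fun i => Function.update (fun _ => (1 : K)) i₀ a i • ω' i).restrictScalars F₀) v) = a • r v) ∧
      -- the module axioms of the `K`-structure `act` on the Weil line (LEMMA-R-RESIDUE §4(d), first sentence):
      -- `act(a + b) = act(a) + act(b)` and `act(0) = 0` on `W_F` (through `r`), `act(a b) = act(a) ∘ act(b)` and
      -- `act(1) = id` everywhere — `(W_F, act)` is a `K`-vector space and `r|_{W_F}` is `K`-linear
      (∀ (a b : K) (w : ⋀[F₀]^(2 * k) VB), w ∈ WF → exteriorPower.map (2 * k)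
        ((ω'.constr K fun i => Function.update (fun _ => (1 : K)) i₀ (a + b) i • ω' i).restrictScalars F₀) w =
          exteriorPower.map (2 * k)
        ((ω'.constr K fun i => Function.update (fun _ => (1 : K)) i₀ (a) i • ω' i).restrictScalars F₀) w +
          exteriorPower.map (2 * k)
        ((ω'.constr K fun i => Function.update (fun _ => (1 : K)) i₀ (b) i • ω' i).restrictScalars F₀) w) ∧
      (∀ w : ⋀[F₀]^(2 * k) VB, w ∈ WF → exteriorPower.map (2 * k)
        ((ω'.constr K fun i => Function.update (fun _ => (1 : K)) i₀ (0 : K) i • ω' i).restrictScalars F₀) w = 0) ∧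
      (∀ (a b : K) (v : ⋀[F₀]^(2 * k) VB), exteriorPower.map (2 * k)
        ((ω'.constr K fun i => Function.update (fun _ => (1 : K)) i₀ (a * b) i • ω' i).restrictScalars F₀) v =
          exteriorPower.map (2 * k)
        ((ω'.constr K fun i => Function.update (fun _ => (1 : K)) i₀ (a) i • ω' i).restrictScalars F₀)
          (exteriorPower.map (2 * k)
        ((ω'.constr K fun i => Function.update (fun _ => (1 : K)) i₀ (b) i • ω' i).restrictScalars F₀) v)) ∧
      (∀ v : ⋀[F₀]^(2 * k) VB, exteriorPower.map (2 * k)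
        ((ω'.constr K fun i => Function.update (fun _ => (1 : K)) i₀ (1 : K) i • ω' i).restrictScalars F₀) v = v) ∧
      (∀ L : Set.powersetCard (ι × (K ≃ₐ[F₀] K)) (2 * k),
        (¬ ∃ σ : K ≃ₐ[F₀] K, (L : Finset (ι × (K ≃ₐ[F₀] K))) = lineSet σ) → r.baseChange K (E' L) = 0) ∧
      (∀ (L : Set.powersetCard (ι × (K ≃ₐ[F₀] K)) (2 * k)) (σ : K ≃ₐ[F₀] K),
        (L : Finset (ι × (K ≃ₐ[F₀] K))) = lineSet σ → ∀ b : K,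
        LinearMap.lTensor K ((LinearMap.lsmul K (⋀[K]^(2 * k) VB) b).restrictScalars F₀) (r.baseChange K (E' L)) =
          σ b • r.baseChange K (E' L)) ∧
      (∀ U : (K ≃ₐ[F₀] K) → Set.powersetCard (ι × (K ≃ₐ[F₀] K)) (2 * k),
        (∀ σ, (U σ : Finset (ι × (K ≃ₐ[F₀] K))) = lineSet σ) →
        LinearIndependent K (fun σ => r.baseChange K (E' (U σ))) ∧
        Submodule.span K (Set.range fun σ => r.baseChange K (E' (U σ))) = ⊤) ∧
      (∀ v ∈ WF, r v = 0 → v = 0) ∧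
      (∀ y : ⋀[K]^(2 * k) VB, ∃ v ∈ WF, r v = y) ∧
      IsCompl WF (LinearMap.ker r) ∧
      (∃ s : ⋀[K]^(2 * k) VB →ₗ[F₀] ⋀[F₀]^(2 * k) VB,
        (∀ y, r (s y) = y) ∧ (∀ y, s y ∈ WF) ∧ (∀ w ∈ WF, s (r w) = w)) ∧
      -- the Weil line is a rank-one `K`-module under the first corner's action: `act(a)`-stable, every non-zero
      -- vector generates (`Tier3LemmaR.WeilRankOne` in abstract form)
      (∀ (a : K) (w : ⋀[F₀]^(2 * k) VB), w ∈ WF → exteriorPower.map (2 * k)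
        ((ω'.constr K fun i => Function.update (fun _ => (1 : K)) i₀ a i • ω' i).restrictScalars F₀) w ∈ WF) ∧
      (∀ w ∈ WF, w ≠ 0 → ∀ x ∈ WF, ∃ a : K, x = exteriorPower.map (2 * k)
        ((ω'.constr K fun i => Function.update (fun _ => (1 : K)) i₀ a i • ω' i).restrictScalars F₀) w) ∧
      -- (S2): the rational projector is an `F₀`-combination of the diagonal operators `⋀^{2k}(A′ b)`
      (∃ (N : ℕ) (q : Fin N → F₀) (b : Fin N → (ι → K)),
        e₀ = ∑ m, q m • exteriorPower.map (2 * k) ((ω'.constr K fun i => b m i • ω' i).restrictScalars F₀) ∧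
        -- LEMMA R: the generator `e · m^* η` of the Weil line, and `W_F` in the `ℚ`-span of the pull-backs of `η`
        ∀ (W : Submodule F₀ (⋀[F₀]^(2 * k) Vr)),
          (∀ s : Set.powersetCard (J × (K ≃ₐ[F₀] K)) (2 * k),
            (∃ σ, (s : Finset (J × (K ≃ₐ[F₀] K))) = reducedSet cls tw σ) → E s ∈ W.baseChange K) →
          ∃ η ∈ W, η ≠ 0 ∧
            e₀ (exteriorPower.map (2 * k) M η) ∈ WF ∧ e₀ (exteriorPower.map (2 * k) M η) ≠ 0 ∧
            -- the image of the generator spans `⋀[K]^(2k) VB` over `K`: `∧^{2p}_F H¹(B, ℚ) = F · r(e · m^* η)`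
            r (e₀ (exteriorPower.map (2 * k) M η)) ≠ 0 ∧
            (∀ y : ⋀[K]^(2 * k) VB, ∃! a : K, y = a • r (e₀ (exteriorPower.map (2 * k) M η))) ∧
            ∀ x ∈ WF, ∃ a : K,
              x = exteriorPower.map (2 * k)
                ((ω'.constr K fun i => Function.update (fun _ => (1 : K)) i₀ a i • ω' i).restrictScalars F₀)
                (e₀ (exteriorPower.map (2 * k) M η)) ∧
              x = ∑ m, q m • exteriorPower.map (2 * k)
                ((ω'.constr K fun i => (Function.update (fun _ => (1 : K)) i₀ a * b m) i • ω' i).restrictScalars F₀)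
                (exteriorPower.map (2 * k) M η)) := by
  classical
  obtain ⟨e, E, Φ, e', E', Φ', WF, e₀, r, he1, he1', he2, he2', hscal, hMe, hΦ, hΦ', hE, hE', hWF, he₀mem, he₀id,
      hrepr, hdim, hr, hrsurj, hract, h1, h2, h3, h4, h5, h6, hs, hstable, hrank, N, q, b, hq, hW⟩ :=
    exists_weil_line_correspondence_scalars cls tw hinj hcard ω ω' M hM hact hact' i₀
  exact ⟨e, E, Φ, e', E', Φ', WF, e₀, r, he1, he1', he2, he2', hscal, hMe, hΦ, hΦ', hE, hE', hWF, he₀mem, he₀id,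
    hrepr, hdim, hr, hrsurj, hract,
    fun a b w hw => weil_act_add_of_mem hcard ω' r hr WF h4 i₀ hstable a b w hw,
    fun w hw => weil_act_zero_of_mem hcard ω' r hr WF h4 i₀ hstable w hw,
    fun a b v => weil_act_mul (2 * k) ω' i₀ a b v,
    fun v => weil_act_one (2 * k) ω' i₀ v,
    h1, h2, h3, h4, h5, h6, hs, hstable, hrank, N, q, b, hq, hW⟩

end CorrespondenceModule

end HodgeRepro.Tier3
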